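import Mathlib
import Summits.Ventures.PercRepro.TriangleCapRowT
import Summits.Ventures.PercRepro.TriangleCapRowJTable

/-!
# PercRepro — THE STABILITY TABLE ON EVERY CELL `r ≥ a` OF EVERY ROW `5 ≤ a ≤ 18`: the non-`a`-bipartite second-best
value of the `K₄⁻`-free cherry table on `(k, a, r)`, `2a + r ≤ k`, is EXACTLY
`closed − min (2 (k − a − 3) + 2 (r − a)(a − 2), 2k − 14 + 2 (r − a)(a − 3))` — the `(r − a + 1)`-broom for
`r ≤ 2a − 5`, the one-triangle family for `r ≥ 2a − 4` — and the WHOLE TABLE in one statement (p3, gen 49; part 203g)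

`rowTreg_nonbip_second_best` = part 203f (the bound, `a ≤ j + 4`) + the one-triangle witness `tFamilyGen (k − 1) a
(j + 2)` (part 198c); `rowAll_second_order` / `rowAll_nonbip_second_best`: for EVERY `j` the non-`a`-bipartite gap on
`(k, a, a + j)` is EXACTLY `min {(j + 1)-broom, T}` — the conjecture of part 200x(a) verbatim; `stab_table_T` /
`stab_table_full` in the cell coordinates `(k, a, r)`, the latter with `stabGapFull` covering every `r ≥ 0` (the cells
`r ≤ a − 1` are part 200l's `stab_table`); `cherry_second_best_full`: the second-best value of the cherry table itself
is `closed − 2 (r − 2)` on every cell `r ≥ 3` of every row `5 ≤ a ≤ 18`, `2a + r ≤ k` (the brooms of the `a`-side).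
Axioms: standard.
-/

namespace PercRepro

namespace TriangleCap

namespace C047

open Finset

/-- The one-triangle gap is the smaller of the two families exactly when `a ≤ j + 4`. -/
theorem tGap_le_broomGap (k a j : ℕ) (ha3 : 3 ≤ a) (haj : a ≤ j + 4) (hk : a + 3 ≤ k) (hk7 : 7 ≤ k) :
    2 * k - 14 + 2 * j * (a - 3) ≤ 2 * (k - a - 3) + 2 * j * (a - 2) := by
  have e : a - 2 = (a - 3) + 1 := by omega
  rw [e, mul_add, mul_one]
  omega

/-- The broom gap is the smaller of the two families when `j + 4 ≤ a`. -/
theorem broomGap_le_tGap (k a j : ℕ) (ha : j + 4 ≤ a) (hk : a + 3 ≤ k) (hk7 : 7 ≤ k) :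
    2 * (k - a - 3) + 2 * j * (a - 2) ≤ 2 * k - 14 + 2 * j * (a - 3) := by
  have e : a - 2 = (a - 3) + 1 := by omega
  rw [e, mul_add, mul_one]
  omega

/-- **THE NON-BIPARTITE SECOND-BEST VALUE ON THE CELL `(k, a, a + j)`, `5 ≤ a ≤ j + 4`, `a ≤ 18`, `3a + j ≤ k`:**
EXACTLY `m k − (a + j)(k − 1 − (a + j)) − (2k − 14 + 2j (a − 3))`, attained by the one-triangle family
`tFamilyGen (k − 1) a (j + 2)`. -/
theorem rowTreg_nonbip_second_best (k a j : ℕ) (ha5 : 5 ≤ a) (haj : a ≤ j + 4) (ha18 : a ≤ 18)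
    (hk : 3 * a + j ≤ k) :
    (∀ (D : SimpleGraph (Fin k)) [DecidableRel D.Adj], K4mFree D → D.edgeFinset.card + (a + j) = a * (k - a) →
        (¬ ∃ A : Finset (Fin k), A.card = a ∧ BipSub D A) →
        ∑ v, deg D v * deg D v + (a + j) * (k - 1 - (a + j)) + (2 * k - 14 + 2 * j * (a - 3)) ≤
          D.edgeFinset.card * k) ∧
      ∃ (D : SimpleGraph (Fin k)) (_ : DecidableRel D.Adj), K4mFree D ∧ D.edgeFinset.card + (a + j) = a * (k - a) ∧
        (¬ ∃ A : Finset (Fin k), A.card = a ∧ BipSub D A) ∧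
        ∑ v, deg D v * deg D v + (a + j) * (k - 1 - (a + j)) + (2 * k - 14 + 2 * j * (a - 3)) =
          D.edgeFinset.card * k := by
  have hcard : Fintype.card (Fin k) = k := Fintype.card_fin k
  refine ⟨?_, ?_⟩
  · intro D _ hK hm hnb
    rcases rowTreg_second_order D hK a j ha5 haj ha18 (by rw [hcard]; exact hk) (by rw [hcard]; exact hm)
      with h | h
    · exact absurd h hnb
    · rw [hcard] at h
      exact h
  · obtain ⟨n, rfl⟩ : ∃ n, k = n + 1 := ⟨k - 1, by omega⟩
    obtain ⟨hK, hE, hS, hnb⟩ := tFamilyGen_value n a (j + 2) (by omega) (by omega) (by omega)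
    refine ⟨tFamilyGen n a (j + 2) (by omega), inferInstance, hK, ?_, fun ⟨A, _, hB⟩ => hnb A hB, ?_⟩
    · have e : j + 2 + a - 2 = a + j := by omega
      rw [e] at hE
      exact hE
    · have e : j + 2 + a - 2 = a + j := by omega
      rw [e] at hS
      have e2 : 2 * (n - 2 * a) + 2 * (j + 2) * (a - 3) = 2 * (n + 1) - 14 + 2 * j * (a - 3) := by
        have h1 : 2 * a ≤ n := by omega
        have h2 : 3 ≤ a := by omega
        have h3 : 14 ≤ 2 * (n + 1) := by omega
        zify [h1, h2, h3]
        ring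
      rw [add_assoc, e2] at hS
      exact hS

variable {V : Type*} [Fintype V] [DecidableEq V]

/-- **EVERY ROW `r = a + j` OF THE STABILITY TABLE, EVERY `j`, `5 ≤ a ≤ 18`, `3a + j ≤ k`:** `K₄⁻`-free,
`m + (a + j) = a (k − a)` ⇒ `a`-bipartite or
`Σ_v d(v)² + (a + j)(k − 1 − (a + j)) + min (2 (k − a − 3) + 2j (a − 2)) (2k − 14 + 2j (a − 3)) ≤ m k`. -/
theorem rowAll_second_order (D : SimpleGraph V) [DecidableRel D.Adj] (hK : K4mFree D) (a j : ℕ)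
    (ha5 : 5 ≤ a) (ha18 : a ≤ 18) (hk : 3 * a + j ≤ Fintype.card V)
    (hm : D.edgeFinset.card + (a + j) = a * (Fintype.card V - a)) :
    (∃ A : Finset V, A.card = a ∧ BipSub D A) ∨
      ∑ v, deg D v * deg D v + (a + j) * (Fintype.card V - 1 - (a + j)) +
          min (2 * (Fintype.card V - a - 3) + 2 * j * (a - 2)) (2 * Fintype.card V - 14 + 2 * j * (a - 3)) ≤
        D.edgeFinset.card * Fintype.card V := by
  rcases Nat.lt_or_ge (j + 4) a with hja | hja
  · rcases rowJ_second_order D hK a j (by omega) ha18 hk hm with h | h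
    · exact Or.inl h
    · right
      have hle := broomGap_le_tGap (Fintype.card V) a j (by omega) (by omega) (by omega)
      rw [min_eq_left hle]
      exact h
  · rcases rowTreg_second_order D hK a j ha5 hja ha18 hk hm with h | h
    · exact Or.inl h
    · right
      have hle := tGap_le_broomGap (Fintype.card V) a j (by omega) hja (by omega) (by omega)
      rw [min_eq_right hle]
      exact h

/-- **THE NON-BIPARTITE SECOND-BEST VALUE ON EVERY CELL `(k, a, a + j)`, EVERY `j`, `5 ≤ a ≤ 18`, `3a + j ≤ k`:**
EXACTLY `m k − (a + j)(k − 1 − (a + j)) − min (2 (k − a − 3) + 2j (a − 2)) (2k − 14 + 2j (a − 3))`, attained by the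
`(j + 1)`-broom (`a ≥ j + 5`) or the one-triangle family (`a ≤ j + 4`). -/
theorem rowAll_nonbip_second_best (k a j : ℕ) (ha5 : 5 ≤ a) (ha18 : a ≤ 18) (hk : 3 * a + j ≤ k) :
    (∀ (D : SimpleGraph (Fin k)) [DecidableRel D.Adj], K4mFree D → D.edgeFinset.card + (a + j) = a * (k - a) →
        (¬ ∃ A : Finset (Fin k), A.card = a ∧ BipSub D A) →
        ∑ v, deg D v * deg D v + (a + j) * (k - 1 - (a + j)) +
            min (2 * (k - a - 3) + 2 * j * (a - 2)) (2 * k - 14 + 2 * j * (a - 3)) ≤ D.edgeFinset.card * k) ∧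
      ∃ (D : SimpleGraph (Fin k)) (_ : DecidableRel D.Adj), K4mFree D ∧ D.edgeFinset.card + (a + j) = a * (k - a) ∧
        (¬ ∃ A : Finset (Fin k), A.card = a ∧ BipSub D A) ∧
        ∑ v, deg D v * deg D v + (a + j) * (k - 1 - (a + j)) +
            min (2 * (k - a - 3) + 2 * j * (a - 2)) (2 * k - 14 + 2 * j * (a - 3)) = D.edgeFinset.card * k := by
  have hcard : Fintype.card (Fin k) = k := Fintype.card_fin k
  refine ⟨?_, ?_⟩
  · intro D _ hK hm hnb
    rcases rowAll_second_order D hK a j ha5 ha18 (by rw [hcard]; exact hk) (by rw [hcard]; exact hm) with h | h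
    · exact absurd h hnb
    · rw [hcard] at h
      exact h
  · rcases Nat.lt_or_ge (j + 4) a with hja | hja
    · have hle := broomGap_le_tGap k a j (by omega) (by omega) (by omega)
      rw [min_eq_left hle]
      exact (rowJ_nonbip_second_best k a j (by omega) ha18 hk).2
    · have hle := tGap_le_broomGap k a j (by omega) hja (by omega) (by omega)
      rw [min_eq_right hle]
      exact (rowTreg_nonbip_second_best k a j ha5 hja ha18 hk).2

/-- **THE NON-BIPARTITE STABILITY TABLE ON EVERY CELL `r ≥ a` OF EVERY ROW `5 ≤ a ≤ 18`**, `2a + r ≤ k`: the second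
best is EXACTLY `closed − min (2 (k − a − 3) + 2 (r − a)(a − 2)) (2k − 14 + 2 (r − a)(a − 3))`, attained. -/
theorem stab_table_T (k a r : ℕ) (ha5 : 5 ≤ a) (ha18 : a ≤ 18) (har : a ≤ r) (hk : 2 * a + r ≤ k) :
    (∀ (D : SimpleGraph (Fin k)) [DecidableRel D.Adj], K4mFree D → D.edgeFinset.card + r = a * (k - a) →
        (¬ ∃ A : Finset (Fin k), A.card = a ∧ BipSub D A) →
        ∑ v, deg D v * deg D v + r * (k - 1 - r) +
            min (2 * (k - a - 3) + 2 * (r - a) * (a - 2)) (2 * k - 14 + 2 * (r - a) * (a - 3)) ≤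
          D.edgeFinset.card * k) ∧
      ∃ (D : SimpleGraph (Fin k)) (_ : DecidableRel D.Adj), K4mFree D ∧ D.edgeFinset.card + r = a * (k - a) ∧
        (¬ ∃ A : Finset (Fin k), A.card = a ∧ BipSub D A) ∧
        ∑ v, deg D v * deg D v + r * (k - 1 - r) +
            min (2 * (k - a - 3) + 2 * (r - a) * (a - 2)) (2 * k - 14 + 2 * (r - a) * (a - 3)) =
          D.edgeFinset.card * k := by
  obtain ⟨j, rfl⟩ : ∃ j, r = a + j := ⟨r - a, by omega⟩
  have e : a + j - a = j := by omega
  rw [e]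
  exact rowAll_nonbip_second_best k a j ha5 ha18 (by omega)

/-- **THE NON-BIPARTITE GAP OF THE STABILITY TABLE ON EVERY CELL:** `2 (k − 2a − 1)(a − r)` for `r ≤ a − 3`,
`2 (k − 2a − 1)` for `r ∈ {a − 2, a − 1}`, and `min {(r − a + 1)-broom, one-triangle}` for `r ≥ a`. -/
def stabGapFull (k a r : ℕ) : ℕ :=
  if r + 3 ≤ a then 2 * (k - 2 * a - 1) * (a - r)
  else if r + 1 ≤ a then 2 * (k - 2 * a - 1)
  else min (2 * (k - a - 3) + 2 * (r - a) * (a - 2)) (2 * k - 14 + 2 * (r - a) * (a - 3))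

/-- `stabGapFull` agrees with `stabGap` on `r ≤ a − 1`. -/
theorem stabGapFull_eq_stabGap (k a r : ℕ) (hr : r + 1 ≤ a) : stabGapFull k a r = stabGap k a r := by
  unfold stabGapFull stabGap
  by_cases h3 : r + 3 ≤ a
  · simp [h3]
  · simp [h3, hr]

/-- **THE WHOLE STABILITY TABLE OF THE `K₄⁻`-FREE CHERRY TABLE, ROWS `5 ≤ a ≤ 18`, EVERY `r`, `2a + r ≤ k`,
`2a + 2 ≤ k`:** every non-`a`-bipartite `K₄⁻`-free graph on `Fin k` with `a (k − a) − r` edges has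
`Σ_v d(v)² + r (k − 1 − r) + stabGapFull k a r ≤ m k`, and the value is attained by a non-`a`-bipartite graph. -/
theorem stab_table_full (k a r : ℕ) (ha5 : 5 ≤ a) (ha18 : a ≤ 18) (hk : 2 * a + r ≤ k) (hk2 : 2 * a + 2 ≤ k) :
    (∀ (D : SimpleGraph (Fin k)) [DecidableRel D.Adj], K4mFree D → D.edgeFinset.card + r = a * (k - a) →
        (¬ ∃ A : Finset (Fin k), A.card = a ∧ BipSub D A) →
        ∑ v, deg D v * deg D v + r * (k - 1 - r) + stabGapFull k a r ≤ D.edgeFinset.card * k) ∧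
      ∃ (D : SimpleGraph (Fin k)) (_ : DecidableRel D.Adj), K4mFree D ∧ D.edgeFinset.card + r = a * (k - a) ∧
        (¬ ∃ A : Finset (Fin k), A.card = a ∧ BipSub D A) ∧
        ∑ v, deg D v * deg D v + r * (k - 1 - r) + stabGapFull k a r = D.edgeFinset.card * k := by
  rcases Nat.lt_or_ge r a with hr | hr
  · rw [stabGapFull_eq_stabGap k a r (by omega)]
    exact stab_table k a r ha5 ha18 (by omega) hk hk2
  · have hgap : stabGapFull k a r =
        min (2 * (k - a - 3) + 2 * (r - a) * (a - 2)) (2 * k - 14 + 2 * (r - a) * (a - 3)) := by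
      unfold stabGapFull
      have h3 : ¬ r + 3 ≤ a := by omega
      have h1 : ¬ r + 1 ≤ a := by omega
      simp [h3, h1]
    rw [hgap]
    exact stab_table_T k a r ha5 ha18 hr hk

/-- Both families are at least `2 (r − 2)` below on `r ≥ a`: the `a`-bipartite brooms stay the second best. -/
theorem two_sub_le_min_gap (k a j : ℕ) (ha5 : 5 ≤ a) (hk : 3 * a + j ≤ k) :
    2 * (a + j - 2) ≤ min (2 * (k - a - 3) + 2 * j * (a - 2)) (2 * k - 14 + 2 * j * (a - 3)) := by
  apply le_min
  · obtain ⟨a', rfl⟩ : ∃ a', a = a' + 5 := ⟨a - 5, by omega⟩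
    have e2 : a' + 5 + j - 2 = a' + 3 + j := by omega
    have e3 : a' + 5 - 2 = a' + 3 := by omega
    rw [e2, e3]
    have e4 : k - (a' + 5) - 3 = k - (a' + 8) := by omega
    rw [e4]
    obtain ⟨c, rfl⟩ : ∃ c, k = a' + 8 + c := ⟨k - (a' + 8), by omega⟩
    rw [Nat.add_sub_cancel_left]
    nlinarith [Nat.zero_le (j * a')]
  · obtain ⟨a', rfl⟩ : ∃ a', a = a' + 5 := ⟨a - 5, by omega⟩
    have e2 : a' + 5 + j - 2 = a' + 3 + j := by omega
    have e3 : a' + 5 - 3 = a' + 2 := by omega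
    rw [e2, e3]
    obtain ⟨c, rfl⟩ : ∃ c, k = 3 * (a' + 5) + j + c := ⟨k - (3 * (a' + 5) + j), by omega⟩
    have e4 : 2 * (3 * (a' + 5) + j + c) - 14 = 6 * a' + 16 + 2 * j + 2 * c := by omega
    rw [e4]
    nlinarith [Nat.zero_le (j * a')]

/-- **THE SECOND-BEST VALUE OF THE CHERRY TABLE ON EVERY CELL `r ≥ 3` OF EVERY ROW `5 ≤ a ≤ 18`**, `2a + r ≤ k`:
`closed − 2 (r − 2)` (the brooms of the `a`-side). -/
theorem cherry_second_best_full (k a r : ℕ) (ha5 : 5 ≤ a) (ha18 : a ≤ 18) (hr3 : 3 ≤ r) (hk : 2 * a + r ≤ k) :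
    (∀ (D : SimpleGraph (Fin k)) [DecidableRel D.Adj], K4mFree D → D.edgeFinset.card + r = a * (k - a) →
        ∑ v, deg D v * deg D v + r * (k - 1 - r) ≠ D.edgeFinset.card * k →
        ∑ v, deg D v * deg D v + r * (k - 1 - r) + 2 * (r - 2) ≤ D.edgeFinset.card * k) ∧
      ∃ (D : SimpleGraph (Fin k)) (_ : DecidableRel D.Adj), K4mFree D ∧ D.edgeFinset.card + r = a * (k - a) ∧
        ∑ v, deg D v * deg D v + r * (k - 1 - r) + 2 * (r - 2) = D.edgeFinset.card * k := by
  rcases Nat.lt_or_ge r a with hr | hr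
  · exact cherry_second_best_table k a r ha5 ha18 hr3 (by omega) hk
  have hcard : Fintype.card (Fin k) = k := Fintype.card_fin k
  refine ⟨?_, ?_⟩
  · intro D _ hK hm hne
    by_cases hnb : ∃ A : Finset (Fin k), A.card = a ∧ BipSub D A
    · obtain ⟨A, hAcard, hB⟩ := hnb
      by_cases hstar : ∃ v, MissingStar D A v
      · obtain ⟨v, hv⟩ := hstar
        have h := closed_form_eq_of_missingStar D A hB hv a r hAcard (by rw [hcard]; exact hm)
          (by rw [hcard]; omega)
        rw [hcard] at h
        exact absurd h hne
      · have h := closed_form_stability_bipSub D A hB a r hAcard (by rw [hcard]; exact hm) (by rw [hcard]; omega)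
          (by omega) hstar
        rw [hcard] at h
        exact h
    · have h := (stab_table_T k a r ha5 ha18 hr hk).1 D hK hm hnb
      obtain ⟨j, rfl⟩ : ∃ j, r = a + j := ⟨r - a, by omega⟩
      have e : a + j - a = j := by omega
      rw [e] at h
      have hge := two_sub_le_min_gap k a j ha5 (by omega)
      omega
  · obtain ⟨D, inst, A, hK, hAcard, hB, hns, hE, hS⟩ := broom_value k a r (by omega) (by omega) (by omega)
    have hr' : r ≤ a * (k - a) := by
      have h2 : 1 * (k - a) ≤ a * (k - a) := Nat.mul_le_mul_right _ (by omega)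
      omega
    have hE' : D.edgeFinset.card + r = a * (k - a) := by rw [hE]; omega
    refine ⟨D, inst, hK, hE', ?_⟩
    rw [hE]
    exact hS

end C047

end TriangleCap

end PercRepro
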